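import Summits.Ventures.CertifiedArithmetic.LowPrec.SignificandErrorValue

/-!
# Pattern route of Theorem E5, part 1: the closed forms as functions of `(N, e)` (the bridge)

HONEST FRAMING (venture CertifiedArithmetic / cell `pub-lowprec`): certified error envelopes and
provably optimal rounding/accumulation schemes for low-precision formats under stated cost models;
every table by two implementations; no hardware or vendor claims.

THEOREMS-R1 Theorem E5 (sec. 3 of `THEOREMS-R1.md`), bookkeeping half, step 1 of 2. The
value-level closed forms of `SignificandErrorValue.lean` take the pattern data `(n, k, s)` of
`|x| = n · 2^s / 2^k · quantum`, `2^(m+k) ≤ n < 2^(m+k+1)`, as GIVEN. An exact product or sum of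
two data arrives instead as `|t| = N · 2^e · quantum_R` with an arbitrary positive integer `N` (the
product, or the aligned sum, of the operands' integral significands) and an INTEGER exponent `e`.
This file computes the pattern from `(N, e)`: the excess width `K = patShift R F N` of `N` over the
destination precision `m + 1` (the kernel-reducible binade search `Format.shiftAux` with any fuel
`F` such that `N < 2^(m+1+F)`), and the relative errors of the four roundings of the tables as
closed forms in `N` ALONE (`rem = N mod 2^K`):
* `patRelErrNE R F N = min(rem, 2^K - rem) / N` — round to nearest (`relErr_roundNE_of_scaled`);
* `patRelErrTZ R F N = rem / N` — toward zero (`relErr_roundTowardZero_of_scaled`) and the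
  toward-zero sides of the directed modes (`relErr_roundDown_of_scaled_pos`,
  `relErr_roundUp_of_scaled_neg`);
* `patRelErrAW R F N = (2^K - rem) / N`, `0` if `rem = 0` — the away sides
  (`relErr_roundDown_of_scaled_neg`, `relErr_roundUp_of_scaled_pos`);
valid whenever `|t|` lies in the NORMAL RANGE `[2^m · quantum_R, maxRat_R]` of the destination —
every binade, the top one included (`e` may be negative), and also for significands `N` SHORTER
than the destination precision (`N < 2^m`: then `K = 0` and all three vanish; the proof pads `N`
to `N · 2^p`, `exists_pow_mul_normal`). The existence of the binade `s ≥ 0` from the normal-range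
hypothesis is `exists_zpow_eq_pow_div`; everything is packaged once in `exists_pattern_of_scaled`.
Also here: the decomposition of a datum's magnitude as `sig · 2^bshift` quanta
(`MiniFloat.sig`, `MiniFloat.bshift`, `abs_toRat_eq_sig`), by which products and sums of data
are brought to the form `N · 2^e · quantum_R` in part 2 (`PatternEnvelopeMul.lean`: the
realisable-and-placeable pattern sets, the computable table constants, soundness, attainment).

Placement: venture development under `Summits/Ventures/CertifiedArithmetic/`; declarations are
dot-notation extensions of the Literature structures `Format` / `MiniFloat` and carry their
absolute `Literature.ComputerArithmetic.FloatingPoint.…` names (CONVENTIONS §2). New work of the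
venture (elementary; [folklore] tags mark statements any numerical analyst would recognise, cf.
[cite: Higham2002ASNA, §2.1]; Knuth, TAOCP vol. 2, §4.2.2).
-/

namespace Literature.ComputerArithmetic.FloatingPoint

/-! ### The closed forms as functions of the significand `N` -/

namespace Format

variable (R : Format)

/-- EXCESS WIDTH of the significand `N` over the precision `m + 1` of `R`: the `K` with
`2^(m+K) ≤ N < 2^(m+K+1)` when `2^m ≤ N < 2^(m+1+F)`, and `0` when `N < 2^(m+1)`; computed by
the structural binade search `shiftAux` with fuel `F` (kernel-reducible). [folklore] -/
def patShift (F N : ℕ) : ℕ := shiftAux R.manBits N F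

/-- PATTERN RELATIVE ERROR, NEAREST: `min(rem, 2^K - rem) / N`, `rem = N mod 2^K`,
`K = patShift R F N`. [folklore] -/
def patRelErrNE (F N : ℕ) : ℚ :=
  ((min (N % 2 ^ R.patShift F N) (2 ^ R.patShift F N - N % 2 ^ R.patShift F N) : ℕ) : ℚ) / N

/-- PATTERN RELATIVE ERROR, TOWARD ZERO: `rem / N`. [folklore] -/
def patRelErrTZ (F N : ℕ) : ℚ := ((N % 2 ^ R.patShift F N : ℕ) : ℚ) / N

/-- PATTERN RELATIVE ERROR, AWAY FROM ZERO: `(2^K - rem) / N`, or `0` when `rem = 0`. [folklore] -/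
def patRelErrAW (F N : ℕ) : ℚ :=
  ((if N % 2 ^ R.patShift F N = 0 then 0 else 2 ^ R.patShift F N - N % 2 ^ R.patShift F N : ℕ)
    : ℚ) / N

variable {R}

/-- `patRelErrNE ≥ 0`. [folklore] -/
theorem patRelErrNE_nonneg (F N : ℕ) : 0 ≤ R.patRelErrNE F N :=
  div_nonneg (Nat.cast_nonneg _) (Nat.cast_nonneg _)

/-- `patRelErrTZ ≥ 0`. [folklore] -/
theorem patRelErrTZ_nonneg (F N : ℕ) : 0 ≤ R.patRelErrTZ F N :=
  div_nonneg (Nat.cast_nonneg _) (Nat.cast_nonneg _)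

/-- `patRelErrAW ≥ 0`. [folklore] -/
theorem patRelErrAW_nonneg (F N : ℕ) : 0 ≤ R.patRelErrAW F N :=
  div_nonneg (Nat.cast_nonneg _) (Nat.cast_nonneg _)

/-- Lower end of the pattern binade: `2^(m+K) ≤ N` when `2^m ≤ N`. [folklore] -/
theorem pow_patShift_le {F N : ℕ} (h : 2 ^ R.manBits ≤ N) :
    2 ^ (R.manBits + R.patShift F N) ≤ N :=
  pow_shiftAux_le _ _ _ h

/-- Upper end of the pattern binade: `N < 2^(m+K+1)` whenever the fuel suffices,
`N < 2^(m+1+F)`. [folklore] -/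
theorem lt_pow_patShift_succ {F N : ℕ} (hF : N < 2 ^ (R.manBits + 1 + F)) :
    N < 2 ^ (R.manBits + R.patShift F N + 1) := by
  have hle : R.patShift F N ≤ F := shiftAux_le _ _ _
  rcases Nat.lt_or_ge (R.patShift F N) F with hlt | hge
  · rw [add_right_comm]
    exact lt_pow_shiftAux R.manBits N F hlt
  · rw [le_antisymm hle hge, add_right_comm]
    exact hF

/-- Short significands have excess width `0`. [folklore] -/
theorem patShift_eq_zero_of_lt {F N : ℕ} (h : N < 2 ^ (R.manBits + 1)) : R.patShift F N = 0 :=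
  shiftAux_eq_zero_of_lt _ _ h

end Format

/-! ### From `(N, e)` to pattern data `(n, k, s)` -/

/-- PADDING: a positive `N < 2^m` has a multiple `N · 2^p` in `[2^m, 2^(m+1))`. [folklore] -/
theorem exists_pow_mul_normal {m N : ℕ} (hN : 0 < N) (hlt : N < 2 ^ m) :
    ∃ p : ℕ, 2 ^ m ≤ N * 2 ^ p ∧ N * 2 ^ p < 2 ^ (m + 1) := by
  induction m with
  | zero => simp at hlt; omega
  | succ m ih =>
    rcases Nat.lt_or_ge N (2 ^ m) with h | h
    · obtain ⟨p, hp1, hp2⟩ := ih h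
      refine ⟨p + 1, ?_, ?_⟩
      · have h2 : N * 2 ^ (p + 1) = N * 2 ^ p * 2 := by ring
        have h3 : 2 ^ (m + 1) = 2 ^ m * 2 := by ring
        rw [h2, h3]; omega
      · have h2 : N * 2 ^ (p + 1) = N * 2 ^ p * 2 := by ring
        have h3 : 2 ^ (m + 1 + 1) = 2 ^ (m + 1) * 2 := by ring
        rw [h2, h3]; omega
    · refine ⟨1, ?_, ?_⟩
      · have h3 : 2 ^ (m + 1) = 2 ^ m * 2 := by ring
        rw [pow_one, h3]; omega
      · have h3 : 2 ^ (m + 1 + 1) = 2 ^ (m + 1) * 2 := by ring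
        rw [pow_one, h3]; omega

/-- THE BINADE IS NON-NEGATIVE: if `2^m ≤ N · 2^e` (normal range, `e : ℤ`) and
`N < 2^(m+k+1)`, then `e + k ≥ 0`, i.e. `2^e = 2^s / 2^k` for a natural `s`. [folklore] -/
theorem exists_zpow_eq_pow_div {m k N : ℕ} {e : ℤ} (hhi : N < 2 ^ (m + k + 1))
    (hle : (2 : ℚ) ^ m ≤ (N : ℚ) * 2 ^ e) : ∃ s : ℕ, (2 : ℚ) ^ e = 2 ^ s / 2 ^ k := by
  have h2 : (2 : ℚ) ≠ 0 := by norm_num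
  obtain ⟨n, hn | hn⟩ := Int.eq_nat_or_neg (e + k)
  · refine ⟨n, ?_⟩
    rw [show e = (n : ℤ) - (k : ℤ) by omega, zpow_sub₀ h2, zpow_natCast, zpow_natCast]
  · have he : e = -((n + k : ℕ) : ℤ) := by push_cast; omega
    rw [he, zpow_neg, zpow_natCast, ← div_eq_mul_inv, le_div_iff₀ (by positivity), ← pow_add]
      at hle
    have h1 : 2 ^ (m + (n + k)) ≤ N := by exact_mod_cast hle
    have h3 := (pow_lt_pow_iff_right₀ (by norm_num : 1 < 2)).mp (lt_of_le_of_lt h1 hhi)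
    have hn0 : n = 0 := by omega
    subst hn0
    refine ⟨0, ?_⟩
    rw [he, zpow_neg, zpow_natCast, zero_add, pow_zero, one_div]

/-- PATTERN DATA OF `N · 2^e · quantum` IN THE NORMAL RANGE (Theorem E5, bookkeeping half, the
bridge): there are `n, k, s` with `2^(m+k) ≤ n < 2^(m+k+1)`, `|t| = n · 2^s / 2^k · quantum`, and
the three pattern errors of `(n, k)` are the closed forms `patRelErrNE/TZ/AW R F N` of `N`
(`n = N`, `k = patShift R F N` if `N ≥ 2^m`; `n = N · 2^p`, `k = 0` otherwise). [folklore] -/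
theorem exists_pattern_of_scaled {R : Format} {t : ℚ} {N F : ℕ} {e : ℤ}
    (hF : N < 2 ^ (R.manBits + 1 + F)) (ht : |t| = (N : ℚ) * 2 ^ e * R.quantum)
    (hlo : 2 ^ R.manBits * R.quantum ≤ |t|) :
    ∃ n k s : ℕ, 2 ^ (R.manBits + k) ≤ n ∧ n < 2 ^ (R.manBits + k + 1) ∧
      |t| = (n : ℚ) * 2 ^ s / 2 ^ k * R.quantum ∧
      ((min (n % 2 ^ k) (2 ^ k - n % 2 ^ k) : ℕ) : ℚ) / n = R.patRelErrNE F N ∧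
      ((n % 2 ^ k : ℕ) : ℚ) / n = R.patRelErrTZ F N ∧
      ((if n % 2 ^ k = 0 then 0 else 2 ^ k - n % 2 ^ k : ℕ) : ℚ) / n = R.patRelErrAW F N := by
  have hq := R.quantum_pos
  have h2 : (2 : ℚ) ≠ 0 := by norm_num
  have hle : (2 : ℚ) ^ R.manBits ≤ (N : ℚ) * 2 ^ e := by
    rw [ht] at hlo
    exact le_of_mul_le_mul_right hlo hq
  have hN : 0 < N := by
    rcases Nat.eq_zero_or_pos N with h | h
    · rw [h, Nat.cast_zero, zero_mul] at hle
      exact absurd hle (not_le.mpr (by positivity))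
    · exact h
  by_cases hmN : 2 ^ R.manBits ≤ N
  · obtain ⟨s, hs⟩ := exists_zpow_eq_pow_div (Format.lt_pow_patShift_succ hF) hle
    refine ⟨N, R.patShift F N, s, Format.pow_patShift_le hmN, Format.lt_pow_patShift_succ hF,
      ?_, rfl, rfl, rfl⟩
    rw [ht, hs]
    ring
  · have hlt : N < 2 ^ R.manBits := not_le.mp hmN
    obtain ⟨p, hp1, hp2⟩ := exists_pow_mul_normal hN hlt
    have hK : R.patShift F N = 0 :=
      Format.patShift_eq_zero_of_lt
        (lt_of_lt_of_le hlt (Nat.pow_le_pow_right (by norm_num) (by omega)))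
    have h2e : (2 : ℚ) ^ e = 2 ^ p * 2 ^ (e - p) := by
      rw [← zpow_natCast, ← zpow_add₀ h2]
      congr 1
      ring
    have hle' : (2 : ℚ) ^ R.manBits ≤ ((N * 2 ^ p : ℕ) : ℚ) * 2 ^ (e - p) := by
      rw [h2e] at hle
      push_cast
      linarith
    obtain ⟨s, hs⟩ := exists_zpow_eq_pow_div (k := 0) (by simpa using hp2) hle'
    refine ⟨N * 2 ^ p, 0, s, by simpa using hp1, by simpa using hp2, ?_, ?_, ?_, ?_⟩
    · rw [ht, h2e, hs]
      push_cast
      ring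
    · simp [Format.patRelErrNE, hK, Nat.mod_one]
    · simp [Format.patRelErrTZ, hK, Nat.mod_one]
    · simp [Format.patRelErrAW, hK, Nat.mod_one]

/-! ### The four roundings of `t` with `|t| = N · 2^e · quantum` in the normal range -/

namespace MiniFloat

open Format

/-- THEOREM E5, PATTERN ROUTE, NEAREST: on the normal range of `R`, the relative `RNE` error of
`t`, `|t| = N · 2^e · quantum_R`, is `patRelErrNE R F N` — a function of `N` alone. [folklore] -/
theorem relErr_roundNE_of_scaled {R : Format} {t : ℚ} {N F : ℕ} {e : ℤ}
    (hF : N < 2 ^ (R.manBits + 1 + F)) (ht : |t| = (N : ℚ) * 2 ^ e * R.quantum)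
    (hlo : 2 ^ R.manBits * R.quantum ≤ |t|) (hhi : |t| ≤ R.maxRat) :
    |t - (roundNE R t).toRat| / |t| = R.patRelErrNE F N := by
  obtain ⟨n, k, s, hlo', hhi', hx, hNE, -, -⟩ := exists_pattern_of_scaled hF ht hlo
  rw [relErr_roundNE_of_pattern hlo' hhi' hx hhi, hNE]

/-- THEOREM E5, PATTERN ROUTE, TOWARD ZERO: the relative `RZ` error is `patRelErrTZ R F N`.
[folklore] -/
theorem relErr_roundTowardZero_of_scaled {R : Format} {t : ℚ} {N F : ℕ} {e : ℤ}
    (hF : N < 2 ^ (R.manBits + 1 + F)) (ht : |t| = (N : ℚ) * 2 ^ e * R.quantum)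
    (hlo : 2 ^ R.manBits * R.quantum ≤ |t|) (hhi : |t| ≤ R.maxRat) :
    |t - (roundTowardZero R t).toRat| / |t| = R.patRelErrTZ F N := by
  obtain ⟨n, k, s, hlo', hhi', hx, -, hTZ, -⟩ := exists_pattern_of_scaled hF ht hlo
  rw [relErr_roundTowardZero_of_pattern hlo' hhi' hx hhi, hTZ]

/-- THEOREM E5, PATTERN ROUTE, ROUND DOWN at `t > 0` (toward-zero side): `patRelErrTZ R F N`.
[folklore] -/
theorem relErr_roundDown_of_scaled_pos {R : Format} {t : ℚ} {N F : ℕ} {e : ℤ} (ht0 : 0 < t)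
    (hF : N < 2 ^ (R.manBits + 1 + F)) (ht : |t| = (N : ℚ) * 2 ^ e * R.quantum)
    (hlo : 2 ^ R.manBits * R.quantum ≤ |t|) (hhi : |t| ≤ R.maxRat) :
    |t - (roundDown R t).toRat| / |t| = R.patRelErrTZ F N := by
  have hq := R.quantum_pos
  obtain ⟨n, k, s, hlo', hhi', hx, -, hTZ, -⟩ := exists_pattern_of_scaled hF ht hlo
  have hn : 0 < n := lt_of_lt_of_le (Nat.two_pow_pos _) hlo'
  rw [sub_roundDown_of_pattern ht0.le hlo' hhi' hx hhi, abs_of_nonneg (by positivity), hx,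
    pattern_err_div_pattern _ hn k s hq, hTZ]

/-- THEOREM E5, PATTERN ROUTE, ROUND DOWN at `t < 0` (away side): `patRelErrAW R F N`.
[folklore] -/
theorem relErr_roundDown_of_scaled_neg {R : Format} {t : ℚ} {N F : ℕ} {e : ℤ} (ht0 : t < 0)
    (hF : N < 2 ^ (R.manBits + 1 + F)) (ht : |t| = (N : ℚ) * 2 ^ e * R.quantum)
    (hlo : 2 ^ R.manBits * R.quantum ≤ |t|) (hhi : |t| ≤ R.maxRat) :
    |t - (roundDown R t).toRat| / |t| = R.patRelErrAW F N := by
  have hq := R.quantum_pos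
  obtain ⟨n, k, s, hlo', hhi', hx, -, -, hAW⟩ := exists_pattern_of_scaled hF ht hlo
  have hn : 0 < n := lt_of_lt_of_le (Nat.two_pow_pos _) hlo'
  rw [sub_roundDown_of_pattern_neg ht0 hlo' hhi' hx hhi, abs_of_nonneg (by positivity), hx,
    pattern_err_div_pattern _ hn k s hq, hAW]

/-- THEOREM E5, PATTERN ROUTE, ROUND UP at `t > 0` (away side): `patRelErrAW R F N`. [folklore] -/
theorem relErr_roundUp_of_scaled_pos {R : Format} {t : ℚ} {N F : ℕ} {e : ℤ} (ht0 : 0 < t)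
    (hF : N < 2 ^ (R.manBits + 1 + F)) (ht : |t| = (N : ℚ) * 2 ^ e * R.quantum)
    (hlo : 2 ^ R.manBits * R.quantum ≤ |t|) (hhi : |t| ≤ R.maxRat) :
    |t - (roundUp R t).toRat| / |t| = R.patRelErrAW F N := by
  have hq := R.quantum_pos
  obtain ⟨n, k, s, hlo', hhi', hx, -, -, hAW⟩ := exists_pattern_of_scaled hF ht hlo
  have hn : 0 < n := lt_of_lt_of_le (Nat.two_pow_pos _) hlo'
  rw [abs_sub_comm, roundUp_sub_of_pattern ht0 hlo' hhi' hx hhi, abs_of_nonneg (by positivity),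
    hx, pattern_err_div_pattern _ hn k s hq, hAW]

/-- THEOREM E5, PATTERN ROUTE, ROUND UP at `t < 0` (toward-zero side): `patRelErrTZ R F N`.
[folklore] -/
theorem relErr_roundUp_of_scaled_neg {R : Format} {t : ℚ} {N F : ℕ} {e : ℤ} (ht0 : t < 0)
    (hF : N < 2 ^ (R.manBits + 1 + F)) (ht : |t| = (N : ℚ) * 2 ^ e * R.quantum)
    (hlo : 2 ^ R.manBits * R.quantum ≤ |t|) (hhi : |t| ≤ R.maxRat) :
    |t - (roundUp R t).toRat| / |t| = R.patRelErrTZ F N := by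
  have hq := R.quantum_pos
  obtain ⟨n, k, s, hlo', hhi', hx, -, hTZ, -⟩ := exists_pattern_of_scaled hF ht hlo
  have hn : 0 < n := lt_of_lt_of_le (Nat.two_pow_pos _) hlo'
  rw [abs_sub_comm, roundUp_sub_of_pattern_neg ht0 hlo' hhi' hx hhi,
    abs_of_nonneg (by positivity), hx, pattern_err_div_pattern _ hn k s hq, hTZ]

/-- From a relative error to the shape of the tables: `|t - f| / |t| ≤ c` gives
`|f - t| ≤ c · |t|`. [folklore] -/
theorem abs_sub_le_mul_of_relErr_le {t f c : ℚ} (ht : 0 < |t|) (h : |t - f| / |t| ≤ c) :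
    |f - t| ≤ c * |t| := by
  rw [abs_sub_comm]
  rwa [div_le_iff₀ ht] at h

/-- Equality version: `|t - f| / |t| = c` gives `|f - t| = c · |t|`. [folklore] -/
theorem abs_sub_eq_mul_of_relErr_eq {t f c : ℚ} (ht : 0 < |t|) (h : |t - f| / |t| = c) :
    |f - t| = c * |t| := by
  rw [abs_sub_comm, ← h, div_mul_cancel₀ _ ht.ne']

/-! ### A datum's magnitude as `sig · 2^bshift` quanta -/

variable {φ : Format}

/-- INTEGRAL SIGNIFICAND of a datum: `T` in the subnormal binade (`E = 0`), else `2^m + T`.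
[cite: IEEE7542019, §3.4] -/
def sig (x : MiniFloat φ) : ℕ := if x.expCode = 0 then x.man else 2 ^ φ.manBits + x.man

/-- BINADE SHIFT of a datum: `E - 1` (`0` in the subnormal binade). [cite: IEEE7542019, §3.4] -/
def bshift (x : MiniFloat φ) : ℕ := x.expCode - 1

/-- `scaledMag = sig · 2^bshift`. [folklore] -/
theorem scaledMag_eq_sig_mul_pow (x : MiniFloat φ) : x.scaledMag = x.sig * 2 ^ x.bshift := by
  unfold scaledMag Format.scaled sig bshift
  split
  · rename_i h
    simp [h]
  · rfl

/-- `sig < 2^(m+1)`. [folklore] -/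
theorem sig_lt (x : MiniFloat φ) : x.sig < 2 ^ (φ.manBits + 1) := by
  have := x.man_lt
  unfold sig
  split <;> rw [pow_succ] <;> omega

/-- `bshift ≤ emaxCode - 1`. [folklore] -/
theorem bshift_le (x : MiniFloat φ) : x.bshift ≤ φ.emaxCode - 1 :=
  Nat.sub_le_sub_right x.expCode_le 1

/-- `sig · 2^bshift ≤ maxScaled`. [folklore] -/
theorem sig_mul_pow_le_maxScaled (x : MiniFloat φ) : x.sig * 2 ^ x.bshift ≤ φ.maxScaled :=
  x.scaledMag_eq_sig_mul_pow ▸ x.scaledMag_le_maxScaled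

/-- `|toRat x| = sig · 2^bshift · quantum`. [folklore] -/
theorem abs_toRat_eq_sig (x : MiniFloat φ) :
    |x.toRat| = (x.sig : ℚ) * 2 ^ x.bshift * φ.quantum := by
  rw [abs_toRat, scaledMag_eq_sig_mul_pow]
  push_cast
  ring

/-- A nonzero datum has `sig ≥ 1`. [folklore] -/
theorem one_le_sig_of_toRat_ne_zero {x : MiniFloat φ} (h : x.toRat ≠ 0) : 1 ≤ x.sig := by
  by_contra h0
  have hs : x.sig = 0 := by omega
  apply h
  rw [← abs_eq_zero, abs_toRat_eq_sig, hs]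
  simp

end MiniFloat

end Literature.ComputerArithmetic.FloatingPoint
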